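/-
Copyright (c) 2026 the pub-hodgecm-mathlib formalisation cell (harness21).  Prover seat hodgecm-mathlib-R90-C133-p02 (g0), Track B ∕ R90-TF, h413 = `stmt-HodgeConjecture-24833`,
R90-TF section S8 «ContSpec-n½» (S8-R149 (3) ∕ S8-R155 (3) «PAIR DET-TWIST N = 3», FILE B): the continued Eisenstein data of a `(χ₁, χ₂)`-pair section of `U(J₃)` TRANSPORT under
the twist by `Θ = ψ∘det` to the `(χ₁·ψ̃⁻¹, χ₂·ψ)`-pair section `φ·Θ` — every clause of the middle-pole generator bundle (★ D1 `resGMidAtomGen`) verbatim, with the same `Sp`.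
-/
import Summits.HodgeConjecture.HodgeConjecture.Theorems.K2E1ChiDetCharBorelU3            -- ★ (this seat, FILE A): `detChar_borel_three`, `mul_detChar_mem_chiSectionSpacePair`
import Summits.HodgeConjecture.HodgeConjecture.Theorems.K2E1ChiEisensteinDetTwistU2       -- ★ (K2E1-p13): GENERIC-`N` twist algebra `eisensteinSeriesU_flatSectionU_mul_automorphicCharacter`, `eq_eisensteinSeriesU_flatSectionU_twist`, `differentiableOn_twist`
import HarnessLib

/-!
# K2·E1 ∕ R90·S8 — `K2E1ChiEisensteinDetTwistU3` (PAIR DET-TWIST, FILE B): THE CONTINUATION ∕ POLE-LETTER CLAUSES OF A PAIR SECTION TRANSPORT UNDER `φ ↦ φ·(ψ∘det)`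
# to the `(χ₁·ψ̃⁻¹, χ₂·ψ)`-pair currency — at `N = 3`, any real pole `z₀` (the middle pole `3/2` and the top pole `2` alike)

Track B ∕ R90-TF, crux h413 = `stmt-HodgeConjecture-24833`, route of record `HCCMUnconditional`; cell `hodgecm-mathlib`, R90-TF section S8 «ContSpec-n½», the (V)(i) road: the continued
family `Ec hE2 hE4 …` of the S8 PAIR block `(ξ.bcη⁻¹·ξ.bcψ⁻¹·μω, ξ.ψ)` obtained by TWIST from the single-character block `(ξ.bcη⁻¹·μω, 1)` (★ `chiEisenstein_meromorphic_exports_level_cm_three`).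
THEOREMS ONLY (no `def`, no `instance`, no `notation`, no named-fact hypothesis, no `sorry`; default heartbeats); lane `--supports stmt-HodgeConjecture-24833 --as helper` (count-neutral).
CLOSES NO SOCKET.  Generic quadratic datum `(F, E, c)`, `[E : F] = 2`, `c ≠ 1`, `U(J₃)`.

THE MATHEMATICS ([Rogawski1990, §13.3 p. 202]; [MoeglinWaldspurger1995, II.1.5, IV.1.11]).  `Θ = ψ∘det` is an automorphic character, so `E(f·Θ) = E(f)·Θ` with NO convergence hypothesis
(★ `eisensteinSeriesU_mul_automorphicCharacter`, `tsum_mul_right`) and `flatSectionU (φ·Θ) z = flatSectionU φ z · Θ` (★ `flatSectionU_mul`).  Hence if `(Ec, Sp)` continues `z ↦ E(φ_z)`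
(holomorphic on `{1 < Re} ∖ Sp`, `= E(φ_z)` on `{2 < Re}`) then `(Ec·Θ, Sp)` continues `z ↦ E((φΘ)_z)`; a pole letter `Fp` of `Ec` at `z₀` (`Fp g` analytic at `z₀`, `= (z − z₀)·Ec z g` near
`z₀`) gives the pole letter `Fp·Θ` of `Ec·Θ`; the residue FUNCTION is multiplied by `Θ`: `x ↦ Fp((out x)⁻¹)(z₀)·Θ((out x)⁻¹)`.  With FILE A (`φ·Θ ∈ V(χ₁·ψ̃⁻¹, χ₂·ψ; K′, ω·Θ|_{K′})`)
this is the complete D1 clause bundle of ★ `resGMidAtomGen` for the twisted section — the payers of the pair block plug the ★ single-character exports BY NAME.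
* §1 (any `N`, any multiplier `θ`) `pole_letter_twist_at` (the `z₀`-generic twin of ★ `pole_letter_twist`), `midClauses_twist` (holomorphy on the slit domain + tube identity + pole letter, one bundle).
* §2 (`N = 3`) **`pairGeneratorClauses_mul_detChar`** — THE HEAD: section membership + continuity + the four continuation clauses + the two pole-letter clauses for `φ·Θ`, from those of `φ`.
HONEST LABEL: HC_CM is proved only modulo the 7 printed citations (2 remaining named inputs: hLiu418 = `stmt-HodgeConjecture-24832`, h413 = `stmt-HodgeConjecture-24833`) until
rung 0 closes; REL ≠ ★ ≠ BUILT; letter-free (pure transport); asserts no named fact and closes no socket; count-neutral.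

## References
* [Rogawski1990] J. D. Rogawski, *Automorphic Representations of Unitary Groups in Three Variables* (1990), §13.3 p. 202.
* [MoeglinWaldspurger1995] C. Mœglin, J.-L. Waldspurger, *Spectral Decomposition and Eisenstein Series* (1995), II.1.5, IV.1.11.
-/

set_option autoImplicit false
set_option linter.dupNamespace false  -- the mandated `…HodgeConjecture.HodgeConjecture.Cruxes.H413…` namespace repeats the summit's segment

noncomputable section

open NumberField IsDedekindDomain Filter Topology Set
open scoped MatrixGroups
open Literature.NumberTheory.Automorphic Literature.NumberTheory.Automorphic.UnitaryGroup Literature.NumberTheory.GaloisRepresentations AdelicGroupData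
open Literature.NumberTheory.Automorphic.Arthur2013.Leaves.TECR
open Summit.HodgeConjecture.HodgeConjecture.Cruxes.H413.K2E1BorelEisensteinU
open Summit.HodgeConjecture.HodgeConjecture.Cruxes.H413.K2E1CharacterEisensteinU2Defs
open Summit.HodgeConjecture.HodgeConjecture.Cruxes.H413.K2E1CharacterEisensteinU3PairDefs
open Summit.HodgeConjecture.HodgeConjecture.Cruxes.H413.K2E1ChiSectionSpaceU3PairDefs
open Summit.HodgeConjecture.HodgeConjecture.Cruxes.H413.K2E1ChiDetCharBorelU3
open Summit.HodgeConjecture.HodgeConjecture.Cruxes.H413.K2E1ChiEisensteinDetTwistU2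

namespace Summit.HodgeConjecture.HodgeConjecture.Cruxes.H413.K2E1ChiEisensteinDetTwistU3

/-! ## §1 Generic `N`: pole letters at any `z₀` and the continuation bundle under a twist -/

section Generic

variable {F E : Type} [Field F] [NumberField F] [Field E] [NumberField E] [Algebra F E] {c : E ≃ₐ[F] E} {N : ℕ} [NeZero N]

omit [NeZero N] in
/-- **The pole letter at ANY `z₀` passes to the twist** (`z₀`-generic twin of ★ `pole_letter_twist`): `Fp g` analytic at `z₀` with `Fp g = (z − z₀)·Ec z g` near `z₀` ⟹ the same for
`z ↦ Fp g z · θ g` and `Ec·θ`. [cite: MoeglinWaldspurger1995, IV.1.11] -/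
theorem pole_letter_twist_at (Ec : ℂ → (quasiSplit F E c N).Adelic → ℂ) (Fp : (quasiSplit F E c N).Adelic → ℂ → ℂ) {z₀ : ℂ} (hF : ∀ g, AnalyticAt ℂ (Fp g) z₀)
    (hFE : ∀ g, Fp g =ᶠ[𝓝[≠] z₀] fun z => (z - z₀) * Ec z g) (θ : (quasiSplit F E c N).Adelic → ℂ) :
    (∀ g, AnalyticAt ℂ (fun z => Fp g z * θ g) z₀) ∧ ∀ g, (fun z => Fp g z * θ g) =ᶠ[𝓝[≠] z₀] fun z => (z - z₀) * (Ec z g * θ g) := by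
  refine ⟨fun g => (hF g).mul analyticAt_const, fun g => ?_⟩
  filter_upwards [hFE g] with z hz
  rw [hz, mul_assoc]

/-- **The continuation bundle passes to the twist by an automorphic character** (same finite set `Sp`): holomorphy of `z ↦ Ec z g · Θ g` on the slit domain, and the tube identity
`Ec z · Θ = E(flatSectionU (φ·Θ) z)` for `2 < Re z` (★ `eq_eisensteinSeriesU_flatSectionU_twist`, no convergence needed). [cite: MoeglinWaldspurger1995, II.1.5, IV.1.11] [cite: Rogawski1990, §13.3 p. 202] -/
theorem midClauses_twist (Θ : (quasiSplit F E c N).AutomorphicCharacter) {φ : (quasiSplit F E c N).Adelic → ℂ}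
    {Ec : ℂ → (quasiSplit F E c N).Adelic → ℂ} {Sp : Finset ℂ}
    (hol : ∀ g, DifferentiableOn ℂ (fun z => Ec z g) ({z : ℂ | 1 < z.re} \ (↑Sp : Set ℂ)))
    (hEc : ∀ z : ℂ, 2 < z.re → Ec z = eisensteinSeriesU (flatSectionU φ z)) :
    (∀ g, DifferentiableOn ℂ (fun z => Ec z g * ((Θ g : ℂˣ) : ℂ)) ({z : ℂ | 1 < z.re} \ (↑Sp : Set ℂ))) ∧
      ∀ z : ℂ, 2 < z.re → (fun x => Ec z x * ((Θ x : ℂˣ) : ℂ)) = eisensteinSeriesU (flatSectionU (fun x => φ x * ((Θ x : ℂˣ) : ℂ)) z) := by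
  refine ⟨fun g => (hol g).mul_const _, fun z hz => ?_⟩
  funext x
  rw [hEc z hz, eisensteinSeriesU_flatSectionU_mul_automorphicCharacter]

end Generic

/-! ## §2 `N = 3`: the full generator clause bundle of a pair section transports under `φ ↦ φ·(ψ∘det)` -/

section Three

variable {F E : Type} [Field F] [NumberField F] [Field E] [NumberField E] [Algebra F E] {c : E ≃ₐ[F] E}
  (h2 : Module.finrank F E = 2) (hc : c ≠ 1) (hJ : ((StdForm.antidiagonal 3).over E).det ≠ 0)

/-- **THE HEAD — PAIR GENERATOR CLAUSES TRANSPORT UNDER THE `ψ∘det`-TWIST.**  For an automorphic `ψ` of `U(1)(𝔸_F)`, `Θ = detChar ψ`, a continuous `φ ∈ V(χ₁, χ₂; K′, ω)` with continuation data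
`(Ec, Sp)` (holomorphic on `{1 < Re} ∖ Sp`, `= E(φ_z)` on `{2 < Re}`) and a pole letter `Fp` at a point `z₀`: the twisted section `φ·Θ` is continuous, lies in `V(χ₁·ψ̃⁻¹, χ₂·ψ; K′, ω·Θ|_{K′})`
(★ FILE A), `(Ec·Θ, Sp)` continues its Eisenstein family, and `Fp·Θ` is its pole letter at `z₀` — i.e. every clause of ★ D1 `resGMidAtomGen` (there `z₀ = 3/2`) for `φ·Θ`, with residue function
`x ↦ Fp((out x)⁻¹)(z₀) · Θ((out x)⁻¹)`. [cite: Rogawski1990, §13.3 p. 202] [cite: MoeglinWaldspurger1995, II.1.5, IV.1.11] -/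
theorem pairGeneratorClauses_mul_detChar (ψ : ↥(TorusDict.torus c) →ₜ* ℂˣ) (hψ : TorusDict.IsAutomorphic c ψ)
    {χ₁ : HeckeCharacter E} {χ₂ : ↥(TorusDict.torus c) →ₜ* ℂˣ} {K' : Subgroup (quasiSplit F E c 3).Adelic} {ω : ↥K' → ℂ}
    {φ : (quasiSplit F E c 3).Adelic → ℂ} (hφ : φ ∈ chiSectionSpacePair χ₁ χ₂ K' ω) (hφc : Continuous φ)
    {Ec : ℂ → (quasiSplit F E c 3).Adelic → ℂ} {Sp : Finset ℂ}
    (hol : ∀ g, DifferentiableOn ℂ (fun z => Ec z g) ({z : ℂ | 1 < z.re} \ (↑Sp : Set ℂ)))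
    (hEc : ∀ z : ℂ, 2 < z.re → Ec z = eisensteinSeriesU (flatSectionU φ z))
    {z₀ : ℂ} {Fp : (quasiSplit F E c 3).Adelic → ℂ → ℂ} (hF : ∀ g, AnalyticAt ℂ (Fp g) z₀) (hFE : ∀ g, Fp g =ᶠ[𝓝[≠] z₀] fun z => (z - z₀) * Ec z g) :
    (fun x => φ x * ((detChar F E c h2 hc 3 ((StdForm.antidiagonal 3).over E) ψ hψ hJ x : ℂˣ) : ℂ)) ∈
        chiSectionSpacePair (χ₁ * (TorusDict.pullback c h2 hc ψ hψ)⁻¹) (χ₂ * ψ) K' (fun k => ω k * ((detChar F E c h2 hc 3 ((StdForm.antidiagonal 3).over E) ψ hψ hJ (k : (quasiSplit F E c 3).Adelic) : ℂˣ) : ℂ)) ∧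
      Continuous (fun x => φ x * ((detChar F E c h2 hc 3 ((StdForm.antidiagonal 3).over E) ψ hψ hJ x : ℂˣ) : ℂ)) ∧
      (∀ g, DifferentiableOn ℂ (fun z => (fun z x => Ec z x * ((detChar F E c h2 hc 3 ((StdForm.antidiagonal 3).over E) ψ hψ hJ x : ℂˣ) : ℂ)) z g) ({z : ℂ | 1 < z.re} \ (↑Sp : Set ℂ))) ∧
      (∀ z : ℂ, 2 < z.re → (fun z x => Ec z x * ((detChar F E c h2 hc 3 ((StdForm.antidiagonal 3).over E) ψ hψ hJ x : ℂˣ) : ℂ)) z = eisensteinSeriesU (flatSectionU (fun x => φ x * ((detChar F E c h2 hc 3 ((StdForm.antidiagonal 3).over E) ψ hψ hJ x : ℂˣ) : ℂ)) z)) ∧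
      (∀ g, AnalyticAt ℂ ((fun g z => Fp g z * ((detChar F E c h2 hc 3 ((StdForm.antidiagonal 3).over E) ψ hψ hJ g : ℂˣ) : ℂ)) g) z₀) ∧
      (∀ g, (fun g z => Fp g z * ((detChar F E c h2 hc 3 ((StdForm.antidiagonal 3).over E) ψ hψ hJ g : ℂˣ) : ℂ)) g =ᶠ[𝓝[≠] z₀] fun z => (z - z₀) * (fun z x => Ec z x * ((detChar F E c h2 hc 3 ((StdForm.antidiagonal 3).over E) ψ hψ hJ x : ℂˣ) : ℂ)) z g) := by
  obtain ⟨hhol, htube⟩ := midClauses_twist (detChar F E c h2 hc 3 ((StdForm.antidiagonal 3).over E) ψ hψ hJ) hol hEc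
  obtain ⟨hFa, hFe⟩ := pole_letter_twist_at Ec Fp hF hFE (fun x : (quasiSplit F E c 3).Adelic => ((detChar F E c h2 hc 3 ((StdForm.antidiagonal 3).over E) ψ hψ hJ x : ℂˣ) : ℂ))
  exact ⟨mul_detChar_mem_chiSectionSpacePair h2 hc hJ ψ hψ hφ, hφc.mul (detChar F E c h2 hc 3 ((StdForm.antidiagonal 3).over E) ψ hψ hJ).continuous, hhol, htube, hFa, hFe⟩

end Three

end Summit.HodgeConjecture.HodgeConjecture.Cruxes.H413.K2E1ChiEisensteinDetTwistU3

end
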